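import Summits.MatrixMultiplication.MatrixMultiplication.Theorems.FarEdgeDescentConeDial
import HarnessLib

/-!
# Route `FarEdgeDescent` — Kernel XXII-D «carrier geometry of the generic crux»

decomp-mm ROOT cell (D-0178), lens 2 «structural dichotomy: special vs generic», gen 46; Theses-free
(imports XXII-C and through it XXI/XXII and `Literature` only; every field `K`; the generic item text
`ALC_K : ∀ m > 1, e(m)² ≤ e(1)·e(2m−1)` INLINE).  Cut of record UNCHANGED.  Notation: `θ = specMMPoint K φ`,
`d(φ) = θ₁+θ₂+θ₃−2`, `ε(φ) = 1−θ₂`, `e(x) = ω_K(1,x,1) − (x+1)`, `τ = e(1) = ω_K − 2`; a format `m = 1+t`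
(`t > 0`) has the ANCHORED PARTNER `2m−1 = 1+2t`; `φ` CARRIES `x` iff `θ₁ + xθ₂ + θ₃ = ω_K(1,x,1)`, i.e.
`d(φ) − (x−1)ε(φ) = e(x)` (carriers exist for every real `x ≥ 0`, XXII-B `exists_carrier`).

WHERE THE GENERIC CRUX LIVES ON THE SPECTRUM (door U11 of the lineage, spectral side).
§1 THE ARITHMETIC-MEAN SHADOW IS A THEOREM: `e(m) ≤ (e(1) + e(2m−1))/2` for every real `m ≥ 1`, every
   field (`excess_midpoint_le`: the carrier of `m` has `d ≤ τ` and `d − 2tε ≤ e(2m−1)`, and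
   `e(m) = d − tε` is the average) — the generic item is exactly its AM → GM upgrade: `ALC_K ⟺` the DISC
   form `e(m)² + ((τ − e(2m−1))/2)² ≤ ((τ + e(2m−1))/2)²` (`alcShape_iff_disc`), i.e. the crux asks for the
   variance term `((τ − e(2m−1))/2)²` on top of convexity.
§2 SUFFICIENT, POINTWISE: if the carrier `φ` of `m = 1+t` lies in the region
   `R_t : t²·ε² ≤ (τ − d)(d − 2tε)` of the shadow plane, then `e(m)² ≤ τ·e(2m−1)` (`alcAt_of_carrier`).
   Top points (`d = τ`) lie in no `R_t` unless `ε = 0` — consistent with top isolation (XXI-B).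
§3 NECESSARY, POINTWISE: if `e(m)² ≤ τ·e(2m−1)` then EVERY carrier `φ'` of the partner `2m−1` lies in
   `N_t : (d − tε)² ≤ τ(d − 2tε)` (`carrier_region_of_alcAt`); hence such far carriers are shallow,
   `4t·ε·τ ≤ τ²` (`far_carrier_shallow_of_alcAt`: `ε(φ') ≤ τ/(4t)` when `ω_K > 2`), and non-top for `t > 0`.
   SANDWICH: `φ_m ∈ R_t ⟹ ALC_K(m) ⟹ φ_{2m−1} ∈ N_t` — the generic crux at `m` is decided by WHERE the two
   carriers of the anchored pair sit; both regions are explicit conics in the `(ε,d)`-plane.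
§4 UNDER THE ITEM (`ALC_K`, every field): all carriers of all formats `x > 1` lie in `N_{(x−1)/2}`
   (`carriers_in_region_of_alc`), a closed condition cutting the top corner out of the carrier locus:
   with `ω_K > 2` every carrier of `x > 1` has `d < τ` (`carrier_nonTop_of_alc`, = top isolation again, now
   as the boundary of a region) and depth `ε ≤ τ/(2(x−1))`.

§5 BAND SEPARATION (UNCONDITIONAL, every field): every carrier of a format `x > 1` is at most as deep
   as EVERY top point (`carrier_shallower_than_top`: the lower exit line of XXII-B through the top point
   meets the carrier's support line; also `Σθ ≥ ω_K − (x−1)(θ₂(φ) − θ₂(G))`), so the shadow splits along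
   the depth line `θ₂ = 1 − σ_K` into the CARRYING BAND `θ₂ ≥ 1 − σ_K` (special: computes every
   `ω_K(1,x,1)`, `x > 1`) and the TOP BAND `θ₂ ≤ 1 − σ_K` (generic: computes `ω_K`), the level attained
   (`band_separation`); and `ω_K = 2 ⟺` every carrier of every format `x > 1` is light
   (`omega_eq_two_iff_carriers_light`) — the lens's exhaustion in carrier language.
§6 ONE NAMED POINT: the middle flattening point `ζ⁽²⁾ = (1,1,0)` (CVZ Ex. 1.4, universal over every
   field, LIGHT) carries `x` iff `ω_K(1,x,1) = x+1` (`gaugePoint₂_carries_iff`); so (`dichotomy_on_gaugePoint₂`)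
   `S_K ⟺ ζ⁽²⁾` is TOP, `FS_K`-shape `⟺ ζ⁽²⁾` carries some `k ≥ 2`, `E(M) ⟺ ζ⁽²⁾` carries `M+1`: the
   special/generic dial of XXII-C is «how close to the square does the flattening point carry», and the
   exit slope `1 − σ_K` of XXII-B is the depth gap between the top band and `ζ⁽²⁾`'s level `θ₂ = 1`.

NO definitions (gate rule D-0009).  Nothing here proves `ω = 2`.
References: [cite: Strassen1988, Thm. 3.8]; [cite: AlmanLi2026, Proposition 4.1, Proposition 4.2];
[cite: LottiRomani1983, Prop. 4.1]; [cite: Zuiddam2018, Thm. 2.15]; [cite: ChristandlVranaZuiddam2023, Example 1.4].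
-/

set_option linter.dupNamespace false

noncomputable section

open scoped BigOperators

namespace Summit.MatrixMultiplication.MatrixMultiplication.Theorems.FarEdgeDescentCarrierGeometry

open Literature.Computability.AlgebraicComplexity
open Summit.MatrixMultiplication.MatrixMultiplication.Theorems.FarEdgeDescentSpectralShadow
open Summit.MatrixMultiplication.MatrixMultiplication.Theorems.FarEdgeDescentSpectralHorn
open Summit.MatrixMultiplication.MatrixMultiplication.Theorems.FarEdgeDescentFieldNode
open Summit.MatrixMultiplication.MatrixMultiplication.Theorems.FarEdgeDescentSpectralAbundance
open Summit.MatrixMultiplication.MatrixMultiplication.Theorems.FarEdgeDescentExitSlope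

variable {K : Type} [Field K]

/-! ## §1 The arithmetic-mean shadow is a theorem; the crux is the disc form -/

/-- **Midpoint convexity of the excess along anchored pairs** (every field, unconditional): for every
real `m ≥ 1`, `e(m) ≤ (e(1) + e(2m−1))/2` — read off the carrier of `m`. [cite: Strassen1988, Thm. 3.8]
[cite: Zuiddam2018, Thm. 2.15] [cite: LottiRomani1983, Prop. 4.1] -/
theorem excess_midpoint_le {m : ℝ} (hm : 1 ≤ m) :
    omegaRect K 1 m 1 - (m + 1) ≤ ((omega K - 2) + (omegaRect K 1 (2 * m - 1) 1 - 2 * m)) / 2 := by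
  obtain ⟨F, hF, hcar⟩ := exists_carrier (K := K) (by linarith : (0 : ℝ) ≤ m)
  have h1 := AlmanLi2026.prop42_sum_le_omega hF
  rw [sum_three] at h1
  have h2 := line_le_omegaRect hF (by linarith : (0 : ℝ) ≤ 2 * m - 1)
  linarith

/-- **The generic item is the AM → GM upgrade**: the text of `AnchoredLogConvexity` over `K` is
equivalent to the DISC form `e(m)² + ((τ − e(2m−1))/2)² ≤ ((τ + e(2m−1))/2)²` for all `m > 1`
(`GM² = AM² − (half-difference)²`). [cite: LottiRomani1983, Prop. 4.1] -/
theorem alcShape_iff_disc :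
    (∀ m : ℝ, 1 < m →
      (omegaRect K 1 m 1 - (m + 1)) ^ 2 ≤ (omegaRect K 1 1 1 - 2) * (omegaRect K 1 (2 * m - 1) 1 - 2 * m)) ↔
    ∀ m : ℝ, 1 < m →
      (omegaRect K 1 m 1 - (m + 1)) ^ 2 + ((omegaRect K 1 1 1 - 2 - (omegaRect K 1 (2 * m - 1) 1 - 2 * m)) / 2) ^ 2 ≤
        ((omegaRect K 1 1 1 - 2 + (omegaRect K 1 (2 * m - 1) 1 - 2 * m)) / 2) ^ 2 := by
  refine forall_congr' fun m => forall_congr' fun _ => ?_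
  constructor <;> intro h <;> nlinarith [h]

/-! ## §2 Sufficient, pointwise: the carrier of `m` in the region `R_t` -/

/-- **ALC at `m` from the position of its carrier** (every field): if `φ` carries `m = 1+t`, `t > 0`,
and `t²ε² ≤ (τ − d)(d − 2tε)`, then `e(m)² ≤ τ·e(2m−1)` (`e(m) = d − tε`, `d ≤ τ`, `d − 2tε ≤ e(2m−1)`).
[cite: Strassen1988, Thm. 3.8] [cite: AlmanLi2026, Proposition 4.2] -/
theorem alcAt_of_carrier {F : SpectralMap K} (hF : IsUniversalSpectralPoint K F) {m : ℝ} (hm : 1 < m)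
    (hcar : specMMPoint K F 0 + m * specMMPoint K F 1 + specMMPoint K F 2 = omegaRect K 1 m 1)
    (hR : (m - 1) ^ 2 * (1 - specMMPoint K F 1) ^ 2 ≤
      (omega K - 2 - ((∑ i, specMMPoint K F i) - 2)) *
        (((∑ i, specMMPoint K F i) - 2) - 2 * (m - 1) * (1 - specMMPoint K F 1))) :
    (omegaRect K 1 m 1 - (m + 1)) ^ 2 ≤ (omega K - 2) * (omegaRect K 1 (2 * m - 1) 1 - 2 * m) := by
  have hsum := AlmanLi2026.prop42_sum_le_omega hF
  rw [sum_three] at hR hsum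
  have hfar := line_le_omegaRect hF (by linarith : (0 : ℝ) ≤ 2 * m - 1)
  -- `e(m) = d − tε`
  have hem : omegaRect K 1 m 1 - (m + 1) =
      (specMMPoint K F 0 + specMMPoint K F 1 + specMMPoint K F 2 - 2) - (m - 1) * (1 - specMMPoint K F 1) := by
    rw [← hcar]; ring
  -- `τ·e(2m−1) ≥ τ·(d − 2tε)`
  have hτ : 0 ≤ omega K - 2 := by
    have := add_one_le_omegaRect_one_mid_one K 1
    rw [omegaRect_one_one_one] at this
    linarith
  have h1 : (omega K - 2) * ((specMMPoint K F 0 + specMMPoint K F 1 + specMMPoint K F 2 - 2) -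
      2 * (m - 1) * (1 - specMMPoint K F 1)) ≤ (omega K - 2) * (omegaRect K 1 (2 * m - 1) 1 - 2 * m) :=
    mul_le_mul_of_nonneg_left (by linarith) hτ
  rw [hem]
  nlinarith

/-- **Top points lie in no region `R_t`** (`t > 0`, `ω_K > 2`): for a top point the right side of `R_t`
vanishes while `t²ε² > 0` (`ε > 0` by the horn) — the pointwise form of top isolation.
[cite: LottiRomani1983, Prop. 4.1] -/
theorem top_not_in_region (hω : 2 < omega K) {F : SpectralMap K} (hF : IsUniversalSpectralPoint K F)
    (htop : ∑ i, specMMPoint K F i = omega K) {t : ℝ} (ht : 0 < t) :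
    ¬ t ^ 2 * (1 - specMMPoint K F 1) ^ 2 ≤
      (omega K - 2 - ((∑ i, specMMPoint K F i) - 2)) *
        (((∑ i, specMMPoint K F i) - 2) - 2 * t * (1 - specMMPoint K F 1)) := by
  have hε : 0 < 1 - specMMPoint K F 1 := by linarith [(top_coord_mem_Ioo hω hF htop 1).2]
  rw [htop, sub_self, zero_mul, not_le]
  positivity

/-! ## §3 Necessary, pointwise: the carriers of the partner `2m−1` in the region `N_t` -/

/-- **ALC at `m` pins the far carrier** (every field): if `e(m)² ≤ τ·e(2m−1)` and `φ'` carries `2m−1`,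
then `(d − tε)² ≤ τ·(d − 2tε)` with `t = m−1` (`d − tε ≤ e(m)`, `d − 2tε = e(2m−1) ≥ 0`).
[cite: Strassen1988, Thm. 3.8] [cite: LottiRomani1983, Prop. 4.1] -/
theorem carrier_region_of_alcAt {m : ℝ} (hm : 1 < m)
    (hA : (omegaRect K 1 m 1 - (m + 1)) ^ 2 ≤ (omega K - 2) * (omegaRect K 1 (2 * m - 1) 1 - 2 * m))
    {F : SpectralMap K} (hF : IsUniversalSpectralPoint K F)
    (hcar : specMMPoint K F 0 + (2 * m - 1) * specMMPoint K F 1 + specMMPoint K F 2 =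
      omegaRect K 1 (2 * m - 1) 1) :
    (((∑ i, specMMPoint K F i) - 2) - (m - 1) * (1 - specMMPoint K F 1)) ^ 2 ≤
      (omega K - 2) * (((∑ i, specMMPoint K F i) - 2) - 2 * (m - 1) * (1 - specMMPoint K F 1)) := by
  rw [sum_three]
  have hmid := line_le_omegaRect hF (by linarith : (0 : ℝ) ≤ m)
  have hfar0 := add_one_le_omegaRect_one_mid_one K (2 * m - 1)
  -- `e(2m−1) = d − 2tε ≥ 0`, hence `d − tε ≥ 0`
  have hefar : omegaRect K 1 (2 * m - 1) 1 - 2 * m =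
      (specMMPoint K F 0 + specMMPoint K F 1 + specMMPoint K F 2 - 2) - 2 * (m - 1) * (1 - specMMPoint K F 1) := by
    rw [← hcar]; ring
  have hε : 0 ≤ 1 - specMMPoint K F 1 := by linarith [(AlmanLi2026.prop42_mem_Icc hF 1).2]
  have hpos : 0 ≤ (specMMPoint K F 0 + specMMPoint K F 1 + specMMPoint K F 2 - 2) -
      (m - 1) * (1 - specMMPoint K F 1) := by nlinarith
  -- `(d − tε)² ≤ e(m)²`
  have hsq : ((specMMPoint K F 0 + specMMPoint K F 1 + specMMPoint K F 2 - 2) -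
      (m - 1) * (1 - specMMPoint K F 1)) ^ 2 ≤ (omegaRect K 1 m 1 - (m + 1)) ^ 2 :=
    pow_le_pow_left₀ hpos (by linarith) 2
  rw [← hefar]
  exact hsq.trans hA

/-- **Far carriers are shallow under ALC at `m`** (every field): with `φ'` carrying `2m−1` and
`e(m)² ≤ τ·e(2m−1)`, `4(m−1)·ε(φ')·τ ≤ τ²` (from `a(τ−a) ≤ τ²/4` with `a = d − tε`); for `ω_K > 2` this
is `ε(φ') ≤ τ/(4(m−1))`. [cite: Strassen1988, Thm. 3.8] -/
theorem far_carrier_shallow_of_alcAt {m : ℝ} (hm : 1 < m)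
    (hA : (omegaRect K 1 m 1 - (m + 1)) ^ 2 ≤ (omega K - 2) * (omegaRect K 1 (2 * m - 1) 1 - 2 * m))
    {F : SpectralMap K} (hF : IsUniversalSpectralPoint K F)
    (hcar : specMMPoint K F 0 + (2 * m - 1) * specMMPoint K F 1 + specMMPoint K F 2 =
      omegaRect K 1 (2 * m - 1) 1) :
    4 * (m - 1) * (1 - specMMPoint K F 1) * (omega K - 2) ≤ (omega K - 2) ^ 2 := by
  have h := carrier_region_of_alcAt hm hA hF hcar
  rw [sum_three] at h
  nlinarith [h, sq_nonneg (omega K - 2 - 2 * ((specMMPoint K F 0 + specMMPoint K F 1 + specMMPoint K F 2 - 2) -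
    (m - 1) * (1 - specMMPoint K F 1)))]

/-! ## §4 Under the item: the carrier locus avoids the top corner -/

/-- **All carriers of all formats `x > 1` lie in `N_{(x−1)/2}`** under the text of `AnchoredLogConvexity`
over `K` (apply §3 at `m = (x+1)/2`). [cite: LottiRomani1983, Prop. 4.1] [cite: Strassen1988, Thm. 3.8] -/
theorem carriers_in_region_of_alc
    (hA : ∀ m : ℝ, 1 < m →
      (omegaRect K 1 m 1 - (m + 1)) ^ 2 ≤ (omegaRect K 1 1 1 - 2) * (omegaRect K 1 (2 * m - 1) 1 - 2 * m))
    {F : SpectralMap K} (hF : IsUniversalSpectralPoint K F) {x : ℝ} (hx : 1 < x)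
    (hcar : specMMPoint K F 0 + x * specMMPoint K F 1 + specMMPoint K F 2 = omegaRect K 1 x 1) :
    (((∑ i, specMMPoint K F i) - 2) - (x - 1) / 2 * (1 - specMMPoint K F 1)) ^ 2 ≤
      (omega K - 2) * (((∑ i, specMMPoint K F i) - 2) - (x - 1) * (1 - specMMPoint K F 1)) := by
  have hm : 1 < (x + 1) / 2 := by linarith
  have e1 : 2 * ((x + 1) / 2) - 1 = x := by ring
  have hAm := hA ((x + 1) / 2) hm
  rw [omegaRect_one_one_one, e1] at hAm
  have e2 : 2 * ((x + 1) / 2) = x + 1 := by ring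
  rw [e2] at hAm
  have h := carrier_region_of_alcAt (K := K) hm (by rw [e1, e2]; exact hAm) hF (by rw [e1]; exact hcar)
  have e3 : (x + 1) / 2 - 1 = (x - 1) / 2 := by ring
  have e4 : 2 * ((x - 1) / 2) = x - 1 := by ring
  rw [e3, e4] at h
  exact h

/-- **Under the item with `ω_K > 2`, carriers of formats `x > 1` are non-top and shallow**: `d < τ` and
`2(x−1)·ε ≤ τ` (the boundary of `N_{(x−1)/2}`; top isolation recovered as a region statement).
[cite: LottiRomani1983, Prop. 4.1] [cite: Strassen1988, Thm. 3.8] -/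
theorem carrier_nonTop_of_alc
    (hA : ∀ m : ℝ, 1 < m →
      (omegaRect K 1 m 1 - (m + 1)) ^ 2 ≤ (omegaRect K 1 1 1 - 2) * (omegaRect K 1 (2 * m - 1) 1 - 2 * m))
    (hω : 2 < omega K) {F : SpectralMap K} (hF : IsUniversalSpectralPoint K F) {x : ℝ} (hx : 1 < x)
    (hcar : specMMPoint K F 0 + x * specMMPoint K F 1 + specMMPoint K F 2 = omegaRect K 1 x 1) :
    (∑ i, specMMPoint K F i) < omega K ∧ 2 * (x - 1) * (1 - specMMPoint K F 1) ≤ omega K - 2 := by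
  have h := carriers_in_region_of_alc hA hF hx hcar
  have hsum := AlmanLi2026.prop42_sum_le_omega hF
  have hε : 0 ≤ 1 - specMMPoint K F 1 := by linarith [(AlmanLi2026.prop42_mem_Icc hF 1).2]
  have hfar := line_le_omegaRect hF (by linarith : (0 : ℝ) ≤ x)
  have hlow := add_one_le_omegaRect_one_mid_one K x
  rw [sum_three] at h hsum ⊢
  -- `e(x) = d − (x−1)ε ≥ 0`
  have hex : 0 ≤ (specMMPoint K F 0 + specMMPoint K F 1 + specMMPoint K F 2 - 2) -
      (x - 1) * (1 - specMMPoint K F 1) := by nlinarith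
  have hτ : 0 < omega K - 2 := by linarith
  refine ⟨lt_of_le_of_ne hsum fun htop => ?_, ?_⟩
  swap
  · -- `τ·tε ≤ a(τ − a) ≤ τ²/4` with `a = d − tε`, `t = (x−1)/2`
    have h4 : 4 * ((x - 1) / 2) * (1 - specMMPoint K F 1) * (omega K - 2) ≤ (omega K - 2) ^ 2 := by
      nlinarith [h, sq_nonneg (omega K - 2 - 2 * ((specMMPoint K F 0 + specMMPoint K F 1 +
        specMMPoint K F 2 - 2) - (x - 1) / 2 * (1 - specMMPoint K F 1)))]
    have h5 : 4 * ((x - 1) / 2) * (1 - specMMPoint K F 1) ≤ omega K - 2 :=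
      le_of_mul_le_mul_right (by nlinarith [h4]) hτ
    linarith
  · -- a top carrier: `R`-side vanishes up to `−τ(x−1)ε`, forcing `ε = 0`, but top points have `ε > 0`
    have hε' : 0 < 1 - specMMPoint K F 1 := by
      have := (top_coord_mem_Ioo hω hF (by rw [sum_three]; exact htop) 1).2
      linarith
    rw [htop] at h
    nlinarith [h, mul_pos (mul_pos (by linarith : (0 : ℝ) < x - 1) hε') (by linarith : (0 : ℝ) < omega K - 2)]

/-! ## §5 Band separation (unconditional): carriers below, top fibre above the line `ε = σ_K` -/

/-- **Every carrier of a format `x > 1` is at most as deep as every top point, and near-top in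
proportion to the depth deficit** (every field, unconditional): if `G` is top and `φ` carries `x > 1`
then `θ₂(G) ≤ θ₂(φ)` and `Σθ(φ) ≥ ω_K − (x−1)(θ₂(φ) − θ₂(G))` — the lower exit line through `G`
(XXII-B) meets the support line of `φ`. [cite: Strassen1988, Thm. 3.8] [cite: AlmanLi2026, Proposition 4.2] -/
theorem carrier_shallower_than_top {G F : SpectralMap K} (hG : IsUniversalSpectralPoint K G)
    (htop : ∑ i, specMMPoint K G i = omega K) (hF : IsUniversalSpectralPoint K F) {x : ℝ} (hx : 1 < x)
    (hcar : specMMPoint K F 0 + x * specMMPoint K F 1 + specMMPoint K F 2 = omegaRect K 1 x 1) :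
    specMMPoint K G 1 ≤ specMMPoint K F 1 ∧
      omega K - (x - 1) * (specMMPoint K F 1 - specMMPoint K G 1) ≤ ∑ i, specMMPoint K F i := by
  have h1 := omegaRect_ge_exitLine hG htop (by linarith : (0 : ℝ) ≤ x)
  rw [← hcar] at h1
  have h2 := AlmanLi2026.prop42_sum_le_omega hF
  rw [sum_three] at h2 ⊢
  have hmul : (x - 1) * specMMPoint K G 1 ≤ (x - 1) * specMMPoint K F 1 := by linarith
  refine ⟨?_, by linarith⟩
  by_contra hlt
  push Not at hlt
  have := mul_lt_mul_of_pos_left hlt (by linarith : (0 : ℝ) < x - 1)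
  linarith

/-- **BAND SEPARATION of the shadow** (every field, unconditional): there is a depth level
`s = 1 − σ_K`, ATTAINED by a top point, with every top point at `θ₂ ≤ s` and every carrier of every
format `x > 1` at `θ₂ ≥ s` — the carrying band (special: it computes all `ω_K(1,x,1)`, `x > 1`) and the
top band (generic: it computes `ω_K`) touch only along `θ₂ = 1 − σ_K`. [cite: Strassen1988, Thm. 3.8]
[cite: LottiRomani1983, Prop. 4.1] -/
theorem band_separation :
    ∃ s : ℝ, (∃ G : SpectralMap K, IsUniversalSpectralPoint K G ∧ ∑ i, specMMPoint K G i = omega K ∧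
        specMMPoint K G 1 = s) ∧
      (∀ G : SpectralMap K, IsUniversalSpectralPoint K G → ∑ i, specMMPoint K G i = omega K →
        specMMPoint K G 1 ≤ s) ∧
      ∀ F : SpectralMap K, IsUniversalSpectralPoint K F → ∀ x : ℝ, 1 < x →
        specMMPoint K F 0 + x * specMMPoint K F 1 + specMMPoint K F 2 = omegaRect K 1 x 1 →
          s ≤ specMMPoint K F 1 := by
  obtain ⟨G, hG, htop, hmax⟩ := exists_top_shallowest (K := K)
  exact ⟨specMMPoint K G 1, ⟨G, hG, htop, rfl⟩, hmax,
    fun F hF x hx hcar => (carrier_shallower_than_top hG htop hF hx hcar).1⟩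

/-- **The summit over `K` in carrier language** (every field): `ω_K = 2` iff every carrier of every
format `x > 1` is LIGHT (`θ₂ = 1`) — the carrying band lies on the light face; equivalently `σ_K = 0`
(XXII-C `tangentInvariants`). (⟸: light carriers give `ω_K(1,x,1) = x+1` for all `x > 1`, and the exit
line through a top point then forces `ω_K − 2 ≤ x − 1` for all `x > 1`.) [cite: LottiRomani1983, Prop. 4.1]
[cite: Strassen1988, Thm. 3.8] -/
theorem omega_eq_two_iff_carriers_light :
    omega K = 2 ↔ ∀ F : SpectralMap K, IsUniversalSpectralPoint K F → ∀ x : ℝ, 1 < x →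
      specMMPoint K F 0 + x * specMMPoint K F 1 + specMMPoint K F 2 = omegaRect K 1 x 1 →
        specMMPoint K F 1 = 1 := by
  constructor
  · intro h2 F hF x hx hcar
    rw [excess_eq_zero_of_omega_eq_two h2 (le_of_lt hx)] at hcar
    have hsum := le_antisymm (omega_eq_two_iff_noDark.1 h2 F hF) (AlmanLi2026.prop42_two_le_sum hF)
    rw [sum_three] at hsum
    have hx1 : (x - 1) * (specMMPoint K F 1 - 1) = 0 := by linarith
    rcases mul_eq_zero.1 hx1 with h | h
    · exact absurd h (by linarith)
    · linarith
  · intro h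
    obtain ⟨G, hG, htop⟩ := exists_top (K := K)
    have hG0 : 0 ≤ specMMPoint K G 1 := (AlmanLi2026.prop42_mem_Icc hG 1).1
    -- `ω_K(1,x,1) = x+1` for every `x > 1`, hence `ω_K − 2 ≤ x − 1`
    have hsat : ∀ x : ℝ, 1 < x → omega K - 2 ≤ x - 1 := by
      intro x hx
      obtain ⟨F, hF, hcar⟩ := exists_carrier (K := K) (by linarith : (0 : ℝ) ≤ x)
      have h1 := h F hF x hx hcar
      have hl := light_of_coord_eq_one hF 1 h1
      rw [sum_three] at hl
      have hex := omegaRect_ge_exitLine hG htop (by linarith : (0 : ℝ) ≤ x)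
      rw [← hcar, h1] at hex
      nlinarith [hex, hl, hG0]
    have hω2 : 2 ≤ omega K := by
      have := add_one_le_omegaRect_one_mid_one K 1
      rw [omegaRect_one_one_one] at this
      linarith
    by_contra hne
    have hgt : 2 < omega K := lt_of_le_of_ne hω2 (Ne.symm hne)
    have := hsat (1 + (omega K - 2) / 2) (by linarith)
    linarith

/-! ## §6 One named point: the middle flattening point `ζ⁽²⁾ = (1,1,0)` -/

/-- The middle gauge point (flattening rank, CVZ 2023 Ex. 1.4) is LIGHT: `θ₂(ζ⁽²⁾) = 1`.
[cite: ChristandlVranaZuiddam2023, Example 1.4] [cite: AlmanLi2026, Proposition 4.2 (proof)] -/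
theorem gaugePoint₂_light : specMMPoint K (gaugePoint₂ K) 1 = 1 := by
  rw [specMMPoint_one, gaugePoint₂_matMulTensor (by norm_num)]
  norm_num [Real.logb_self_eq_one]

/-- **`ζ⁽²⁾` carries `x` iff the format `x` is saturated** (every field, every real `x`): its support
line is the flattening bound `x + 1`. [cite: ChristandlVranaZuiddam2023, Example 1.4]
[cite: LottiRomani1983, Prop. 4.1] -/
theorem gaugePoint₂_carries_iff (x : ℝ) :
    specMMPoint K (gaugePoint₂ K) 0 + x * specMMPoint K (gaugePoint₂ K) 1 + specMMPoint K (gaugePoint₂ K) 2 =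
        omegaRect K 1 x 1 ↔ omegaRect K 1 x 1 = x + 1 := by
  have hl := light_of_coord_eq_one (gaugePoint₂_isUniversalSpectralPoint K) 1 (gaugePoint₂_light (K := K))
  rw [sum_three, gaugePoint₂_light] at hl
  rw [gaugePoint₂_light]
  constructor <;> intro h <;> linarith

/-- **THE DICHOTOMY ON ONE NAMED POINT** (every field): the summit over `K` says the flattening point
`ζ⁽²⁾` is TOP (computes `ω_K`); the special item's shape says `ζ⁽²⁾` CARRIES SOME far format `k ≥ 2`;
the cone level `E(M)` of XXII-C says `ζ⁽²⁾` carries `M+1`.  (`S_K ⟺ ζ⁽²⁾` carries every `x ≥ 1`;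
`FS_K ⟺` it carries one `k ≥ 2`; under the generic item the carried set `{x ≥ 1 : e(x) = 0}` is `∅` or
all of `[1,∞)`, XXI-C.) [cite: ChristandlVranaZuiddam2023, Example 1.4] [cite: LottiRomani1983, Prop. 4.1] -/
theorem dichotomy_on_gaugePoint₂ :
    (omega K = 2 ↔ ∑ i, specMMPoint K (gaugePoint₂ K) i = omega K) ∧
    ((∃ k : ℕ, 2 ≤ k ∧ omegaRect K 1 k 1 = k + 1) ↔ ∃ k : ℕ, 2 ≤ k ∧
      specMMPoint K (gaugePoint₂ K) 0 + (k : ℝ) * specMMPoint K (gaugePoint₂ K) 1 +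
        specMMPoint K (gaugePoint₂ K) 2 = omegaRect K 1 k 1) ∧
    ∀ M : ℝ, omegaRect K 1 (M + 1) 1 = M + 2 ↔
      specMMPoint K (gaugePoint₂ K) 0 + (M + 1) * specMMPoint K (gaugePoint₂ K) 1 +
        specMMPoint K (gaugePoint₂ K) 2 = omegaRect K 1 (M + 1) 1 := by
  have hl := light_of_coord_eq_one (gaugePoint₂_isUniversalSpectralPoint K) 1 (gaugePoint₂_light (K := K))
  refine ⟨by rw [hl]; exact ⟨fun h => h.symm, fun h => h.symm⟩, ?_, fun M => ?_⟩
  · exact exists_congr fun k => and_congr_right fun _ => (gaugePoint₂_carries_iff (K := K) k).symm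
  · rw [gaugePoint₂_carries_iff, show M + 1 + 1 = M + 2 by ring]

end Summit.MatrixMultiplication.MatrixMultiplication.Theorems.FarEdgeDescentCarrierGeometry

end
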